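import Summits.Ventures.WeilGRH.DualCertificateSoundness
import Summits.Ventures.WeilGRH.KeyMinorantParity
import HarnessLib

/-!
# GRH arm (rh-explicit, venture WeilGRH): format D WITH ENVELOPES at the level of KEYS —
  one envelope-dual certificate at the all-trivial pseudo-key gives every character of every large modulus

Cell `rh-explicit`, WEIL TRACK — GRH ARM (engine/certificate seat weil-grh-2, gen6).  `DualCertificateSoundness.lean`
(weil-grh-3) types LEMMA D for the full atom grammar of the arm's format D,
`A(τ) = c · τ^j · sinc(wτ/2)^m · (cos | sin)(xτ)` — point masses (`m = 0`) AND box-spline ENVELOPES (`m = 2, 4, 6`: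
triangle / quartic / sextic densities of step `w` centred at `x` on the position side), admissible when
`x − m·w/2 ≥ T ≥ 2t` — at the level of a CHARACTER `χ`.  The kernel-checked variant D-K (`DualTrigKernelKey.lean`)
and the key-level lemma `KeyPolytope.weilPositivityOnKey_of_trigDual` use point masses only; with point masses
the multiplier `T(τ)` is almost periodic and the certificate is TAIL-LIMITED at wide windows (the all-trivial even
key at `t = 1` needs `log q₀ ≥ 5.26` with point masses against the true threshold `4.31`: weil-grh-3 gen4, kit
j182096/j182160).  Envelopes decay (`sinc^m = O(τ^{−m})`), and the cell's LP data (weil-grh-2 gen6, kit j186066: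
triangle envelopes on `[2, 24]` reach `log q₀ = 4.50` at `t = 1`, even) say they remove most of that loss.

This file re-targets LEMMA D WITH ENVELOPES to KEYS (the prime datum `v : ℕ → ℂ` need not come from a character):

* `weilPositivityOnKey_of_dual_nonneg[_list]`: atoms admissible against `T ≥ log(N+1)` and
  `0 ≤ M_{a,L,v,N}(τ) + Σ_i A_i(τ)` for every real `τ` ⇒ `WeilPositivityOnKey a L v N`;
* ★ `weilPositivityOnChar_of_allTrivial_dual_nonneg_list`: ONE such certificate at the all-trivial EVEN key
  `(0, L₀, 1, N)` ⇒ `WeilPositivityOnChar χ t` for EVERY `χ` mod `q ≠ 1` with `L₀ ≤ log q` and every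
  `0 < t ≤ log(N+1)/2` (the MINORANT, `KeyMinorantParity.weilPositivityOnChar_of_weilPositivityOnKey_allTrivial_even`);
  `…_odd_…`: a certificate at the all-trivial ODD key gives every odd character.

So an envelope certificate verified by the arm's float checker (`ivcheck.py`, 110-bit) at the pseudo-key is the
uniform floor `q ≥ e^{L₀}` for every character MODULO the single real inequality `P ≥ 0` on `ℝ` (DATA until a kernel
evaluator for `sinc²` atoms exists); vertices of `KeyPolytope.lean` may be certified the same way.  Everything here
is PROVED; no definitions, no named facts; nothing is claimed about any particular key.

## References

* A. Weil (1952), (11) pp. 261–262 and the «lemme» p. 262 [Weil1952FormulesExplicites]; M. G. Kreĭn (1940),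
  positive-definite extension [folklore]; the arm's format D: weil-grh-3, GRH3-ROUTE.md §1, §1b.
-/

set_option autoImplicit false

noncomputable section

open Complex Set MeasureTheory
open scoped Real

namespace Summit.Ventures.WeilGRH

open Literature.NumberTheory.LFunctions

variable {q : ℕ}

/-- **LEMMA D with envelopes, for KEYS.**  If the atoms `A_i` (`i ∈ s`) are admissible against a rational
`T ≥ log(N+1)` and `0 ≤ M_{a,L,v,N}(τ) + Σ_{i∈s} A_i(τ)` for every real `τ`, then `WeilPositivityOnKey a L v N`
(the atoms integrate to `0` against `|ĝ(1/2+iτ)|²` for test `g` on the window,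
`integral_norm_sq_weilMellin_mul_eval_eq_zero`). [folklore] -/
theorem weilPositivityOnKey_of_dual_nonneg (a : ℕ) (L : ℝ) (v : ℕ → ℂ) (N : ℕ) {T : ℚ}
    (hT : Real.log ((N : ℝ) + 1) ≤ (T : ℝ)) {ι : Type*} (s : Finset ι) (A : ι → WeilDualAtom)
    (hA : ∀ i ∈ s, (A i).admissible T = true)
    (hP : ∀ τ : ℝ, 0 ≤ weilFinitePrimeWeightKey a L v N τ + ∑ i ∈ s, (A i).eval τ) :
    WeilPositivityOnKey a L v N := by
  intro g hg hsupp
  have hT' : 2 * (Real.log ((N : ℝ) + 1) / 2) ≤ (T : ℝ) := by linarith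
  have hiM := integrable_norm_sq_weilMellin_mul_weilFinitePrimeWeightKey hg a L v N
  have hE : ∀ i ∈ s, Integrable fun τ : ℝ ↦ ‖weilMellin g (1 / 2 + τ * I)‖ ^ 2 * (A i).eval τ :=
    fun i _ ↦ integrable_norm_sq_weilMellin_mul_eval hg (A i)
  have hEs : Integrable fun τ : ℝ ↦ ∑ i ∈ s, ‖weilMellin g (1 / 2 + τ * I)‖ ^ 2 * (A i).eval τ :=
    integrable_finsetSum _ hE
  have hsum : ∫ τ : ℝ, ∑ i ∈ s, ‖weilMellin g (1 / 2 + τ * I)‖ ^ 2 * (A i).eval τ = 0 := by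
    rw [integral_finsetSum _ hE]
    exact Finset.sum_eq_zero fun i hi ↦ integral_norm_sq_weilMellin_mul_eval_eq_zero hg hsupp hT' (hA i hi)
  unfold weilFinitePrimeQuadraticKey
  have hsplit : (∫ τ : ℝ, ‖weilMellin g (1 / 2 + τ * I)‖ ^ 2 * weilFinitePrimeWeightKey a L v N τ) =
      ∫ τ : ℝ, ‖weilMellin g (1 / 2 + τ * I)‖ ^ 2 * (weilFinitePrimeWeightKey a L v N τ + ∑ i ∈ s, (A i).eval τ) := by
    have e : (fun τ : ℝ ↦ ‖weilMellin g (1 / 2 + τ * I)‖ ^ 2 *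
        (weilFinitePrimeWeightKey a L v N τ + ∑ i ∈ s, (A i).eval τ)) =
        fun τ : ℝ ↦ ‖weilMellin g (1 / 2 + τ * I)‖ ^ 2 * weilFinitePrimeWeightKey a L v N τ +
          ∑ i ∈ s, ‖weilMellin g (1 / 2 + τ * I)‖ ^ 2 * (A i).eval τ := by
      funext τ
      rw [mul_add, Finset.mul_sum]
    rw [e, integral_add hiM hEs, hsum, add_zero]
  rw [hsplit]
  exact mul_nonneg (by positivity) (integral_nonneg fun τ ↦ mul_nonneg (by positivity) (hP τ))

/-- **List form** (entry point for instance files): atoms as a `List WeilDualAtom`, admissibility decidable by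
`decide`, the dual function as `(L.map (·.eval τ)).sum`. [folklore] -/
theorem weilPositivityOnKey_of_dual_nonneg_list (a : ℕ) (L : ℝ) (v : ℕ → ℂ) (N : ℕ) {T : ℚ}
    (hT : Real.log ((N : ℝ) + 1) ≤ (T : ℝ)) (Lst : List WeilDualAtom) (hA : ∀ A ∈ Lst, A.admissible T = true)
    (hP : ∀ τ : ℝ, 0 ≤ weilFinitePrimeWeightKey a L v N τ + (Lst.map fun A ↦ A.eval τ).sum) :
    WeilPositivityOnKey a L v N :=
  weilPositivityOnKey_of_dual_nonneg a L v N hT (Finset.univ : Finset (Fin Lst.length))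
    (fun i ↦ Lst[(i : ℕ)]) (fun i _ ↦ hA _ (List.getElem_mem i.2))
    (fun τ ↦ by simpa [list_map_eval_sum_eq] using hP τ)

/-- ★ **ONE envelope-dual certificate at the all-trivial EVEN key, EVERY character.**  If the atoms are
admissible against `T ≥ log(N+1)` and `0 ≤ M_{0,L₀,1,N}(τ) + Σ A(τ)` for every real `τ`, then
`WeilPositivityOnChar χ t` for every Dirichlet character `χ` mod `q ≠ 1` (either parity) with `L₀ ≤ log q` and
every `0 < t ≤ log(N+1)/2`. [folklore] -/
theorem weilPositivityOnChar_of_allTrivial_dual_nonneg_list {L₀ : ℝ} {N : ℕ} {T : ℚ}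
    (hT : Real.log ((N : ℝ) + 1) ≤ (T : ℝ)) (Lst : List WeilDualAtom) (hA : ∀ A ∈ Lst, A.admissible T = true)
    (hP : ∀ τ : ℝ, 0 ≤ weilFinitePrimeWeightKey 0 L₀ (fun _ ↦ 1) N τ + (Lst.map fun A ↦ A.eval τ).sum)
    {t : ℝ} (ht : 0 < t) (htN : t ≤ Real.log ((N : ℝ) + 1) / 2) (hq : q ≠ 1) (χ : DirichletCharacter ℂ q)
    (hL : L₀ ≤ Real.log q) : WeilPositivityOnChar χ t :=
  weilPositivityOnChar_of_weilPositivityOnKey_allTrivial_even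
    (weilPositivityOnKey_of_dual_nonneg_list 0 L₀ (fun _ ↦ 1) N hT Lst hA hP) ht htN hq χ hL

/-- The same with the level read off a modulus: a certificate at `(0, log q₀, 1, N)` gives every `χ` mod
`q ≥ q₀ ≥ 1`. [folklore] -/
theorem weilPositivityOnChar_of_allTrivial_dual_nonneg_list_mod {q₀ N : ℕ} {T : ℚ}
    (hT : Real.log ((N : ℝ) + 1) ≤ (T : ℝ)) (Lst : List WeilDualAtom) (hA : ∀ A ∈ Lst, A.admissible T = true)
    (hP : ∀ τ : ℝ, 0 ≤ weilFinitePrimeWeightKey 0 (Real.log q₀) (fun _ ↦ 1) N τ + (Lst.map fun A ↦ A.eval τ).sum)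
    {t : ℝ} (ht : 0 < t) (htN : t ≤ Real.log ((N : ℝ) + 1) / 2) (hq : q ≠ 1) (χ : DirichletCharacter ℂ q)
    (hqq : q₀ ≤ q) (hq₀ : q₀ ≠ 0) : WeilPositivityOnChar χ t :=
  weilPositivityOnChar_of_allTrivial_dual_nonneg_list hT Lst hA hP ht htN hq χ
    (Real.log_le_log (by exact_mod_cast Nat.pos_of_ne_zero hq₀) (by exact_mod_cast hqq))

/-- ★ **ONE envelope-dual certificate at the all-trivial ODD key, every ODD character** (more generally every
character of parity `≥ a₀`): `0 ≤ M_{a₀,L₀,1,N}(τ) + Σ A(τ)` ⇒ `WeilPositivityOnChar χ t` for every `χ` mod `q ≠ 1`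
with `a₀ ≤ charParity χ`, `L₀ ≤ log q`, `0 < t ≤ log(N+1)/2`. [folklore] -/
theorem weilPositivityOnChar_of_allTrivial_dual_nonneg_list_parity {a₀ : ℕ} {L₀ : ℝ} {N : ℕ} {T : ℚ}
    (hT : Real.log ((N : ℝ) + 1) ≤ (T : ℝ)) (Lst : List WeilDualAtom) (hA : ∀ A ∈ Lst, A.admissible T = true)
    (hP : ∀ τ : ℝ, 0 ≤ weilFinitePrimeWeightKey a₀ L₀ (fun _ ↦ 1) N τ + (Lst.map fun A ↦ A.eval τ).sum)
    {t : ℝ} (ht : 0 < t) (htN : t ≤ Real.log ((N : ℝ) + 1) / 2) (hq : q ≠ 1) (χ : DirichletCharacter ℂ q)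
    (ha₀ : a₀ ≤ charParity χ) (hL : L₀ ≤ Real.log q) : WeilPositivityOnChar χ t :=
  weilPositivityOnChar_of_weilPositivityOnKey_allTrivial_any
    (weilPositivityOnKey_of_dual_nonneg_list a₀ L₀ (fun _ ↦ 1) N hT Lst hA hP) ht htN hq χ ha₀ hL

end Summit.Ventures.WeilGRH

end
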